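import Summits.QuantumFields.YangMills.Theorems.BalabanUVNodesN15CovariantAveragingPropagatorRowsReg335
import Summits.QuantumFields.YangMills.Theorems.BalabanUVNodesN15SmallFieldUnitLayerAnyPropagator
import Summits.QuantumFields.YangMills.Theorems.BalabanUVNodesN15CovariantAveragingAllLayersKnit
import HarnessLib

/-!
# N15 = NE2 — PROGRAMME 𝟙P «ONE PROPAGATOR», part (𝟙P-f): ★★★ THE CLOSED ROAD-(c) LITERAL WITH ONE PROPAGATOR IN ALL THREE LAYERS — dag-n15-c's `X_q` (covariant averaging summand live) in
# the OPERATOR layer (193b) AND inside the SITE ∕ UNIT sandwiches ((𝟙P-c)∕(𝟙P-d) at `X_q` by (𝟙P-e″)); `Live ∧ N15At`, pinned threshold, trace-form coordinates, keyed face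
# (dag-n15-a g32, FILE (𝟙P-f); node N15 = NE2; `--supports stmt-QuantumFields-27366 --as helper`, count-neutral; 3 plumbing defs + theorems; imports (𝟙P-e″), (𝟙P-d), (Q-7))

WHY.  LOCATED-X (this seat, 2026-08-29): the g31 literal `sfObjects₅qv` has its operator layer at dag-n15-c's `X_q` (summand live) but its site ∕ unit layers sandwich FILE 133's propagator
(summand FLAT) — two model propagators in one literal, whereas [B9] Thms 3.2 ∕ 3.15 read the SAME `G(U)` as Thm 3.1 («with the same constants»).  This file closes PROGRAMME 𝟙P: the site ∕
unit layers of (𝟙P-c) ∕ (𝟙P-d) — generic in the inner propagator — are instantiated at `X_q` by (𝟙P-e″) `rows_sfq` (one `exact` each, the averaging rows by (Q-6b) `qvCov_rows_sf`), and knitted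
with the operator layer `sfqFamily … (sfqE₄ …)` (193b via (Q-7) `ne2PlusOperator_sfq₄E`) into the closed literal `sfObjects₆qv`: ONE propagator `X_q` in (3.42), (3.48) and (3.187).
§4 records it by `rfl`: the operator layer's entry 0 IS `𝔇(sfqXf, sfqXc)` — the defect of exactly the pair the sandwiches read.

WHAT.  §1 defs `sfqXc` ∕ `sfqXf` (dag-n15-c's `X_q`, `X′_q` as a family over the node index and the potential — 189a `sfqEntry0` l.51–52's two arguments, named), ★ `sfqEntry0_eq_idef_sfqX` (`rfl`),
`rows_sfqX` ((𝟙P-e″) at the named family).  §2 ★★ `ne2PlusSite_foSiteAny_sfq`, ★★ `ne2PlusUnit_foCovAnyLam_sfq` (the node's site ∕ unit conjuncts BY NAME with `X_q` INSIDE the sandwich).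
§3 def `sfObjects₆qv` (the closed literal), `exists_live_and_n15At_sfObjects₆qv`, `wQ6` (pinned threshold, a `Classical.choose`), ★★★ **`live_and_n15At_sfObjects₆qv_wQ6`**, keyed face
`s_N15_of_admits_sf₆qv` (with `hadm` AND the value equation; `ne2At` a binder — no pin, no v8), ★★★ `live_and_n15At_sfObjects₆qv_tf` (`e := tfCoords mm` by (T-1): hypotheses purely numeric +
`mm` nonempty).  (The existence form `∃ O, … Live ∧ N15At` is (Q-7)'s `exists_closed_allCovariant_literal` already — not restated.)

HONEST FRAMING ∕ LIMITS.  By-name bookkeeping on MODEL carriers: dag-n15-c's two-spacing glued doubled torus `sfInstance`, global small-field gauge `u ≡ 1`, `Q(U)` = main term of [5] (125),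
Bałaban's Landau summand `D_UR(U)D*_U` still FLAT (their (P-R) in progress — the same socket will take it), `Reg336` idle, King-block-mean pairing, `L ≥ 7`, `d ≥ 1`, (3.48) reads `G′²` where the
model reads `X`, crude constants, `wQ6` non-explicit.  NOT [B9] Thms 3.1 ∕ 3.2 ∕ 3.14 ∕ 3.15 AS PRINTED.  N15 stays DISCHARGED OF RECORD 8∕28 AS CONSUMED (U-blind v7 pin, p687738) — NO re-pin
asked (FLAG №13 is the director's), nothing re-claimed, no count moved (typed 28∕28 · discharged 8∕28); K3⁸ OPEN; finite 𝕋⁴ per index — NOT ℝ⁴ ∕ OS ∕ mass gap ∕ Clay.  Three plumbing `def`s ⇒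
review ∕ audit lane.  `set_option maxRecDepth 8192 in` ×2 (the `unfold`s of §1 against 189a's literal).  No `sorry`, `instance`, `notation`; standard axioms.
[cite: Balaban1985BackgroundPropagators, Thm 3.1 (3.42) p.397, Thm 3.2 (3.47)–(3.48) p.398 («with the same constants»), Thm 3.15 (3.187) p.432, (3.26) p.395, (3.78)–(3.81) p.406 (templates: MODEL level); Balaban1985Averaging,
(124)–(126) p.36; King1986, Prop. 3.9 (3.73) p.665 (η-rate shape)]
-/

noncomputable section

open scoped BigOperators Matrix

namespace Summit.QuantumFields.YangMills.BalabanUVNodes.N15.SiteLayerSf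

open Literature.MathematicalPhysics.QuantumFieldTheory.Balaban1983to89
open Literature.MathematicalPhysics.QuantumFieldTheory.Balaban1983to89.T4EtaRate (NE2PlusOperator NE2PlusSite NE2PlusUnit)
open Literature.MathematicalPhysics.QuantumFieldTheory.Balaban1983to89.B11SectG (BlockNorm HasMaj)
open Literature.MathematicalPhysics.QuantumFieldTheory.Balaban1983to89.B5Prop11Plancherel (Tor fine)
open Literature.MathematicalPhysics.QuantumFieldTheory.Balaban1983to89.B6UnitTorusCarrier (unitTorusGeo)
open Literature.MathematicalPhysics.QuantumFieldTheory.Balaban1983to89.T4EtaRateDefect (idef)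
open Literature.MathematicalPhysics.QuantumFieldTheory.Balaban1983to89.T4EtaRateCoeffDefect (pull)
open Literature.MathematicalPhysics.QuantumFieldTheory.King1986.Torus (blockOf)
open Literature.Barriers.QuantumFields (traceForm)
open Summit.QuantumFields.YangMills.BalabanUVNodes.N15.BackgroundLayer (gavgM)
open Summit.QuantumFields.YangMills.BalabanUVNodes.N15.VectorPiece (bshiftEquiv kingPrV tensorId)
open Summit.QuantumFields.YangMills.BalabanUVNodes.N15.MatrixSpecies (liftBlk liftMap)
open Summit.QuantumFields.YangMills.BalabanUVNodes.N15.TwoGrid (gOp)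
open Summit.QuantumFields.YangMills.BalabanUVNodes.N15.Gluing (SfIdx sfGeo sfInstance sfFamily sfqFamily sfqEntry0 CvX CvX' cvM cvBlk CvNorm cvNL cvNL' cvGlued cvGlued' cvNVq cvNVq')
open Summit.QuantumFields.YangMills.BalabanUVNodes.N15.PairedFamilyGuard (Live)
open Literature.MathematicalPhysics.QuantumFieldTheory.Balaban1983to89.T4Continuum (T4Family ULoop)
open Node00 (NE2Objects₁₁)
open Summit.QuantumFields.YangMills.BalabanUVNodes.N15.AtKeyedHome (s_N15_of_admits)
open YMDAG.UVSplit (Datum RateCarriers RateRecordPred N15At S_N15 ne2OfRecord₁₁)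

variable (d : ℕ) {L : ℕ} [NeZero L] (mm ι : Type) [Fintype mm] [DecidableEq mm] [Fintype ι] [DecidableEq ι] (a : ℝ) (e : Matrix mm mm ℂ ≃L[ℝ] (ι → ℝ))

open scoped Matrix.Norms.L2Operator

/-! ## §1 dag-n15-c's propagator `X_q` as a family over the node index and the potential; its rows -/

section Family

/-- **dag-n15-c's LIVE GLUED PROPAGATOR WITH THE COVARIANT AVERAGING SUMMAND, COARSE SPACING** `X_q(A′)` — 189a `sfqEntry0` l.52's second argument, as a family over `(i, A′)`:
`cvGlued … (e^{ηĀ′}) (P := cvNL − cvNVq(e^{ηĀ′})) (NV := cvNVq(e^{ηĀ′}))`. [cite: Balaban1985BackgroundPropagators, (3.26) p.395, Thm 3.1 p.397 (shape); Balaban1985Averaging, (124)–(126) p.36] -/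
def sfqXc (hL : Odd L ∧ 1 < L) (i : SfIdx d L) (A' : Fin (d + 1) → CvX' d L i.m i.kk i.r hL → Matrix mm mm ℂ) :
    (CvX d L i.m i.kk hL × ι → ℝ) →ₗ[ℝ] (CvX d L i.m i.kk hL × ι → ℝ) :=
  cvGlued d L i.m i.kk hL a ((((L ^ i.kk : ℕ) : ℝ))⁻¹) ι e (fun _ _ => (1 : Matrix mm mm ℂ)) (fun μ x => NormedSpace.exp (((((L ^ i.kk : ℕ) : ℝ))⁻¹) • gavgM (Matrix mm mm ℂ) (Fin (d + 1)) (kingPrV L i.kk i.r (cvM d L i.m i.kk hL)) A' μ x)) (cvNL d L i.m i.kk hL a ι - (cvNVq d L i.m i.kk hL a ι e (fun μ x => NormedSpace.exp (((((L ^ i.kk : ℕ) : ℝ))⁻¹) • gavgM (Matrix mm mm ℂ) (Fin (d + 1)) (kingPrV L i.kk i.r (cvM d L i.m i.kk hL)) A' μ x)))) (fun _ => (cvNVq d L i.m i.kk hL a ι e (fun μ x => NormedSpace.exp (((((L ^ i.kk : ℕ) : ℝ))⁻¹) • gavgM (Matrix mm mm ℂ) (Fin (d + 1)) (kingPrV L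 i.kk i.r (cvM d L i.m i.kk hL)) A' μ x))))

/-- **THE SAME AT THE FINE SPACING** `X′_q(A′)` — 189a `sfqEntry0` l.51's first argument. [cite: Balaban1985BackgroundPropagators, (3.26) p.395, Thm 3.1 p.397 (shape)] -/
def sfqXf (hL : Odd L ∧ 1 < L) (i : SfIdx d L) (A' : Fin (d + 1) → CvX' d L i.m i.kk i.r hL → Matrix mm mm ℂ) :
    (CvX' d L i.m i.kk i.r hL × ι → ℝ) →ₗ[ℝ] (CvX' d L i.m i.kk i.r hL × ι → ℝ) :=
  cvGlued' d L i.m i.kk i.r hL a ((((L ^ i.r * L ^ i.kk : ℕ) : ℝ))⁻¹) ι e (fun _ _ => (1 : Matrix mm mm ℂ)) (fun μ x' => NormedSpace.exp (((((L ^ i.r * L ^ i.kk : ℕ) : ℝ))⁻¹) • A' μ x')) (cvNL' d L i.m i.kk i.r hL a ι - (cvNVq' d L i.m i.kk i.r hL a ι e (fun μ x' => NormedSpace.exp (((((L ^ i.r * L ^ i.kk : ℕ) : ℝ))⁻¹) • A' μ x')))) (fun _ => (cvNVq' d L i.m i.kk i.r hL a ι e (fun μ x' => NormedSpace.exp (((((L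 ^ i.r * L ^ i.kk : ℕ) : ℝ))⁻¹) • A' μ x'))))

set_option maxRecDepth 8192 in
/-- ★ **ONE PROPAGATOR**: the operator layer's entry 0 (189a `sfqEntry0`, the η-defect row of (3.42)) IS the two-grid defect of EXACTLY the pair `(sfqXf, sfqXc)` the site ∕ unit sandwiches of
§2 read — `rfl`. [bookkeeping] -/
theorem sfqEntry0_eq_idef_sfqX (hL : Odd L ∧ 1 < L) (i : SfIdx d L) (A' : Fin (d + 1) → CvX' d L i.m i.kk i.r hL → Matrix mm mm ℂ) :
    sfqEntry0 d mm ι a e hL i A' =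
      idef (pull (liftMap (kingPrV L i.kk i.r (cvM d L i.m i.kk hL)) ι)) (pull (liftMap (kingPrV L i.kk i.r (cvM d L i.m i.kk hL)) ι)) (sfqXf d mm ι a e hL i A') (sfqXc d mm ι a e hL i A') := by
  unfold sfqEntry0 sfqXf sfqXc
  rfl

variable {d mm ι a e}

set_option maxRecDepth 8192 in
/-- ★★ (𝟙P-e″) `rows_sfq` AT THE NAMED FAMILY: `(sfqXc, sfqXf)` meets (𝟙P-c)'s three displayed rows under the class. [cite: Balaban1985BackgroundPropagators, (3.35) p.396, (3.62)–(3.65) pp.402–403 (shape)] -/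
theorem rows_sfqX [Nonempty ι] [Nonempty mm] (hL : Odd L ∧ 1 < L) (hL7 : 7 ≤ L) (ha : 0 < a) {c35 : ℝ} (hc35 : 0 < c35) (he : ∀ A B : Matrix mm mm ℂ, traceForm A B = e A ⬝ᵥ e B) :
    ∃ ρX KX wX sX : ℝ, 0 < ρX ∧ 0 ≤ KX ∧ 0 < sX ∧
      ∀ (i : SfIdx d L) (α₀ : ℝ) (A' : Fin (d + 1) → CvX' d L i.m i.kk i.r hL → Matrix mm mm ℂ), 0 < α₀ → wX ≤ ((L ^ i.m : ℕ) : ℝ) → c35 * (L : ℝ) ^ i.m * α₀ ≤ sX →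
        (sfInstance d mm ι hL i).Bf.Reg335 c35 α₀ A' →
        HasMaj (CvNorm d L i.m i.kk hL ι) (CvNorm d L i.m i.kk hL ι) (sfqXc d mm ι a e hL i A' - tensorId ι (gOp (cvM d L i.m i.kk hL) (L ^ i.kk) a))
          (fun y y' => KX * (c35 * (L : ℝ) ^ i.m * α₀) * Real.exp (-(ρX * (unitTorusGeo L i.kk (cvM d L i.m i.kk hL)).dist y y'))) ∧
        HasMaj (BlockNorm.ofBlocks (unitTorusGeo L i.kk (cvM d L i.m i.kk hL)) (liftBlk (fun b : CvX' d L i.m i.kk i.r hL => blockOf (L ^ i.r * L ^ i.kk) (cvM d L i.m i.kk hL) b.1) ι))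
          (BlockNorm.ofBlocks (unitTorusGeo L i.kk (cvM d L i.m i.kk hL)) (liftBlk (fun b : CvX' d L i.m i.kk i.r hL => blockOf (L ^ i.r * L ^ i.kk) (cvM d L i.m i.kk hL) b.1) ι))
          (sfqXf d mm ι a e hL i A' - tensorId ι (gOp (cvM d L i.m i.kk hL) (L ^ i.r * L ^ i.kk) a))
          (fun y y' => KX * (c35 * (L : ℝ) ^ i.m * α₀) * Real.exp (-(ρX * (unitTorusGeo L i.kk (cvM d L i.m i.kk hL)).dist y y'))) ∧
        HasMaj (CvNorm d L i.m i.kk hL ι)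
          (BlockNorm.ofBlocks (unitTorusGeo L i.kk (cvM d L i.m i.kk hL)) (liftBlk (fun b : CvX' d L i.m i.kk i.r hL => blockOf (L ^ i.r * L ^ i.kk) (cvM d L i.m i.kk hL) b.1) ι))
          (idef (pull (liftMap (kingPrV L i.kk i.r (cvM d L i.m i.kk hL)) ι)) (pull (liftMap (kingPrV L i.kk i.r (cvM d L i.m i.kk hL)) ι))
            (sfqXf d mm ι a e hL i A' - tensorId ι (gOp (cvM d L i.m i.kk hL) (L ^ i.r * L ^ i.kk) a)) (sfqXc d mm ι a e hL i A' - tensorId ι (gOp (cvM d L i.m i.kk hL) (L ^ i.kk) a)))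
          (fun y y' => KX * ((((L ^ i.kk : ℕ) : ℝ)) ^ (-(1 / 16 : ℝ))) * Real.exp (-(ρX * (unitTorusGeo L i.kk (cvM d L i.m i.kk hL)).dist y y'))) := by
  unfold sfqXc sfqXf
  exact rows_sfq hL hL7 ha hc35 he

end Family

/-! ## §2 The node's site and unit conjuncts BY NAME with `X_q` inside the sandwich -/

section Layers

variable [Nonempty mm]

/-- ★★ **`NE2PlusSite` FOR dag-n15-c's CLASS, THE SITE SANDWICH READING `X_q`** (covariant averaging `Q⊗1 + D` outside AND the covariant-averaging summand live INSIDE the propagator): (𝟙P-c)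
`ne2PlusSite_foSiteAny` at `(sfqXc, sfqXf)` with `rows_sfqX` and (Q-6b) `qvCov_rows_sf` — no displayed row remains. MODEL; NOT [B9] Thm 3.2 as printed.
[cite: Balaban1985BackgroundPropagators, Thm 3.2 (3.47)–(3.48) p.398 («with the same constants»), (3.26) p.395, (3.80)–(3.81) p.406 (shape: MODEL level)] -/
theorem ne2PlusSite_foSiteAny_sfq [Nonempty ι] (hL : Odd L ∧ 1 < L) (hL7 : 7 ≤ L) (ha : 0 < a) {c35 : ℝ} (hc35 : 0 < c35)
    (he : ∀ A B : Matrix mm mm ℂ, traceForm A B = e A ⬝ᵥ e B) (α β : Fin (d + 1)) (j j' : ι) (d' : ℕ) (p : ℝ) :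
    NE2PlusSite d' p c35 (sfInstance d mm ι hL) (foSiteAny d mm ι a hL α β j j' (sfqXc d mm ι a e hL) (sfqXf d mm ι a e hL) (qDc d mm ι e hL) (qEc d mm ι e hL) (qDf d mm ι e hL) (qEf d mm ι e hL)) :=
  ne2PlusSite_foSiteAny d mm ι a hL hL7 ha hc35 α β j j' d' p _ _ _ _ _ _ (rows_sfqX hL hL7 ha hc35 he) (qvCov_rows_sf d mm ι e hL hc35.le)

/-- ★★ **`NE2PlusUnit` FOR dag-n15-c's CLASS, THE DIRICHLET UNIT LAYER READING `X_q`** above a size threshold `w` (`d ≥ 1`): (𝟙P-d) `ne2PlusUnit_foCovAnyLam` at `(sfqXc, sfqXf)`.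
MODEL; NOT [B9] Thm 3.15 as printed. [cite: Balaban1985BackgroundPropagators, Thm 3.15 (3.187) p.432, (3.26) p.395, (3.80)–(3.81) p.406 (shape: MODEL level)] -/
theorem ne2PlusUnit_foCovAnyLam_sfq [Nonempty ι] (hd : 1 ≤ d) (hL : Odd L ∧ 1 < L) (hL7 : 7 ≤ L) (ha : 0 < a) {c35 : ℝ} (hc35 : 0 < c35)
    (he : ∀ A B : Matrix mm mm ℂ, traceForm A B = e A ⬝ᵥ e B) (α β : Fin (d + 1)) (j j' : ι) :
    ∃ w : ℝ, NE2PlusUnit c35 (fun i : SfIdxGE d L w × Finset (Fin (d + 1) → ℤ) => sfInstance d mm ι hL i.1.1)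
      (fun i => foCovAnyLam d mm ι a hL α β j j' (sfqXc d mm ι a e hL) (sfqXf d mm ι a e hL) (qDc d mm ι e hL) (qEc d mm ι e hL) (qDf d mm ι e hL) (qEf d mm ι e hL) i.1.1 i.2)
      (fun i => inLamSf d mm ι hL i.1.1 i.2) (fun i => (sfInstance d mm ι hL i.1.1).gc.dist) :=
  ne2PlusUnit_foCovAnyLam d mm ι a hd hL hL7 ha hc35 α β j j' _ _ _ _ _ _ (rows_sfqX hL hL7 ha hc35 he) (qvCov_rows_sf d mm ι e hL hc35.le)

end Layers

/-! ## §3 The closed literal with ONE propagator in all three layers; pinned threshold; keyed face -/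

section Closed

variable [Nonempty mm]

/-- **THE CLOSED ROAD-(c) LITERAL WITH ONE PROPAGATOR** at a size threshold `w`: operator layer `sfqFamily … (Σ-Q)` (193b: entry 0 = `𝔇(X′_q, X_q)`, entries 1–3 the covariant gradients ∕
Laplacian of `X_q`), site kernel (𝟙P-c) and Dirichlet unit kernel (𝟙P-d) BOTH reading `(sfqXc, sfqXf)` through the constructed covariant averaging `(qDc, qEc, qDf, qEf)`, genuine region
`inLamSf`, on `SfIdxGE d L w × RegIdx0 d`. [bookkeeping] -/
def sfObjects₆qv (hL : Odd L ∧ 1 < L) (ν₁ ν₂ : Fin (d + 1) ⊕ Fin (d + 1)) (α β : Fin (d + 1)) (j j' : ι) (α' β' : Fin (d + 1)) (j₂ j₂' : ι) (c35 p w : ℝ) : NE2Objects₁₁ :=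
  ⟨SfIdxGE d L w × RegIdx0 d, c35, p, fun x => sfInstance d mm ι hL x.1.1, fun x => sfqFamily d mm ι a e hL x.1.1 (sfqE₄ d mm ι a e hL ν₁ ν₂ x.1.1),
    fun x => foSiteAny d mm ι a hL α β j j' (sfqXc d mm ι a e hL) (sfqXf d mm ι a e hL) (qDc d mm ι e hL) (qEc d mm ι e hL) (qDf d mm ι e hL) (qEf d mm ι e hL) x.1.1,
    fun x => foCovAnyLam d mm ι a hL α' β' j₂ j₂' (sfqXc d mm ι a e hL) (sfqXf d mm ι a e hL) (qDc d mm ι e hL) (qEc d mm ι e hL) (qDf d mm ι e hL) (qEf d mm ι e hL) x.1.1 x.2.1, fun x => inLamSf d mm ι hL x.1.1 x.2.1,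
    fun x => (sfInstance d mm ι hL x.1.1).gc.dist⟩

/-- ★★★ **GUARD ∧ `N15At` AT THE ONE-PROPAGATOR LITERAL, SOME THRESHOLD** (`d ≥ 1`, odd `L ≥ 7`, `a, c₃₅ > 0`, trace-form coordinates `e`, `ι`, `mm` nonempty): OPERATOR = (Q-7)
`ne2PlusOperator_sfq₄E`, SITE = §2 `ne2PlusSite_foSiteAny_sfq`, UNIT = §2 `ne2PlusUnit_foCovAnyLam_sfq`, GUARD = (Ð-5) `live_sfGELam`.
[cite: Balaban1985BackgroundPropagators, Thm 3.1 (3.42) p.397, Thm 3.2 (3.47)–(3.48) p.398, Thm 3.15 (3.187) p.432 (templates: MODEL level); Balaban1985Averaging, (124)–(125) p.36] -/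
theorem exists_live_and_n15At_sfObjects₆qv [Nonempty ι] (hd : 1 ≤ d) (hL : Odd L ∧ 1 < L) (hL7 : 7 ≤ L) (ha : 0 < a) {c35 : ℝ} (hc35 : 0 < c35)
    (he : ∀ A B : Matrix mm mm ℂ, traceForm A B = e A ⬝ᵥ e B) (ν₁ ν₂ : Fin (d + 1) ⊕ Fin (d + 1)) (α β : Fin (d + 1)) (j j' : ι) (α' β' : Fin (d + 1)) (j₂ j₂' : ι) (p : ℝ) :
    ∃ w : ℝ, Live (ne2OfRecord₁₁ (sfObjects₆qv d mm ι a e hL ν₁ ν₂ α β j j' α' β' j₂ j₂' c35 p w)) ∧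
      N15At (ne2OfRecord₁₁ (sfObjects₆qv d mm ι a e hL ν₁ ν₂ α β j j' α' β' j₂ j₂' c35 p w)) := by
  obtain ⟨w, hunit⟩ := ne2PlusUnit_foCovAnyLam_sfq d mm ι a e hd hL hL7 ha hc35 he α' β' j₂ j₂'
  exact ⟨w, live_sfGELam d mm ι hL w hc35.le p _ _ _,
    ⟨ne2PlusOperator_comp (fun x : SfIdxGE d L w × RegIdx0 d => x.1.1) (ne2PlusOperator_sfq₄E d mm ι a e hL hL7 ha hc35 he ν₁ ν₂),
      ne2PlusSite_comp (fun x : SfIdxGE d L w × RegIdx0 d => x.1.1) (ne2PlusSite_foSiteAny_sfq d mm ι a e hL hL7 ha hc35 he α β j j' 4 p),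
      ne2PlusUnit_comp (fun x : SfIdxGE d L w × RegIdx0 d => ((x.1, x.2.1) : SfIdxGE d L w × Finset (Fin (d + 1) → ℤ))) hunit⟩⟩

/-- **THE PINNED THRESHOLD** `w_Q6` of the one-propagator literal (a `Classical.choose`; the cube floor is NOT explicit). [bookkeeping] -/
def wQ6 [Nonempty ι] (hd : 1 ≤ d) (hL : Odd L ∧ 1 < L) (hL7 : 7 ≤ L) (ha : 0 < a) {c35 : ℝ} (hc35 : 0 < c35) (he : ∀ A B : Matrix mm mm ℂ, traceForm A B = e A ⬝ᵥ e B)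
    (ν₁ ν₂ : Fin (d + 1) ⊕ Fin (d + 1)) (α β : Fin (d + 1)) (j j' : ι) (α' β' : Fin (d + 1)) (j₂ j₂' : ι) (p : ℝ) : ℝ :=
  Classical.choose (exists_live_and_n15At_sfObjects₆qv d mm ι a e hd hL hL7 ha hc35 he ν₁ ν₂ α β j j' α' β' j₂ j₂' p)

/-- ★★★ **GUARD ∧ `N15At` AT THE ONE-PROPAGATOR LITERAL PINNED AT `w_Q6`** — the lane's most print-faithful `Live ∧ N15At` to date: ONE model propagator `G(U) = X_q` (covariant averaging
summand live) read by (3.42), (3.48) and (3.187) alike, covariant averaging in the sandwich, genuine Dirichlet region; MODEL carriers. [cite: Balaban1985BackgroundPropagators, (3.42) p.397, Thms 3.1∕3.2 p.398, Thm 3.15 p.432 (shape)] -/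
theorem live_and_n15At_sfObjects₆qv_wQ6 [Nonempty ι] (hd : 1 ≤ d) (hL : Odd L ∧ 1 < L) (hL7 : 7 ≤ L) (ha : 0 < a) {c35 : ℝ} (hc35 : 0 < c35)
    (he : ∀ A B : Matrix mm mm ℂ, traceForm A B = e A ⬝ᵥ e B) (ν₁ ν₂ : Fin (d + 1) ⊕ Fin (d + 1)) (α β : Fin (d + 1)) (j j' : ι) (α' β' : Fin (d + 1)) (j₂ j₂' : ι) (p : ℝ) :
    Live (ne2OfRecord₁₁ (sfObjects₆qv d mm ι a e hL ν₁ ν₂ α β j j' α' β' j₂ j₂' c35 p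
        (wQ6 d mm ι a e hd hL hL7 ha hc35 he ν₁ ν₂ α β j j' α' β' j₂ j₂' p))) ∧
      N15At (ne2OfRecord₁₁ (sfObjects₆qv d mm ι a e hL ν₁ ν₂ α β j j' α' β' j₂ j₂' c35 p
        (wQ6 d mm ι a e hd hL hL7 ha hc35 he ν₁ ν₂ α β j j' α' β' j₂ j₂' p))) :=
  Classical.choose_spec (exists_live_and_n15At_sfObjects₆qv d mm ι a e hd hL hL7 ha hc35 he ν₁ ν₂ α β j j' α' β' j₂ j₂' p)

variable {N : ℕ} [NeZero N] {key : (F : T4Family) → Datum F N → Prop}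

/-- ★★ **THE ONE-PROPAGATOR LITERAL AT ANY KEYED HOME** (part 30's interface; `ne2At` a BINDER, `hadm` AND the value equation `h` hypotheses — no pin, no v8): a rate home over ANY key
admitting only the literals of a key-indexed NE2 reading whose value everywhere is the pinned one-propagator literal has `S_N15 RRec`. [bookkeeping] -/
theorem s_N15_of_admits_sf₆qv [Nonempty ι] (hd : 1 ≤ d) (hL : Odd L ∧ 1 < L) (hL7 : 7 ≤ L) (ha : 0 < a) {c35 : ℝ} (hc35 : 0 < c35)
    (he : ∀ A B : Matrix mm mm ℂ, traceForm A B = e A ⬝ᵥ e B) (ν₁ ν₂ : Fin (d + 1) ⊕ Fin (d + 1)) (α β : Fin (d + 1)) (j j' : ι) (α' β' : Fin (d + 1)) (j₂ j₂' : ι) (p : ℝ)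
    (ne2At : ∀ {F : T4Family} {D : Datum F N}, key F D → (ℕ → ℝ) → List (ULoop F) → ℕ → NE2Objects₁₁) (RRec : RateRecordPred N)
    (hadm : ∀ (F : T4Family) (D : Datum F N) (g₀ : ℕ → ℝ) (os : List (ULoop F)) (R : RateCarriers N), RRec F D g₀ os R →
      ∃ (h : key F D) (k : ℕ), R.ne2 = ne2OfRecord₁₁ (ne2At h g₀ os k))
    (h : ∀ (F : T4Family) (D : Datum F N) (h : key F D) (g₀ : ℕ → ℝ) (os : List (ULoop F)) (k : ℕ),
      ne2At h g₀ os k = sfObjects₆qv d mm ι a e hL ν₁ ν₂ α β j j' α' β' j₂ j₂' c35 p (wQ6 d mm ι a e hd hL hL7 ha hc35 he ν₁ ν₂ α β j j' α' β' j₂ j₂' p)) :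
    S_N15 RRec :=
  s_N15_of_admits ne2At RRec hadm fun F D hk g₀ os k => by
    rw [h F D hk g₀ os k]
    exact (live_and_n15At_sfObjects₆qv_wQ6 d mm ι a e hd hL hL7 ha hc35 he ν₁ ν₂ α β j j' α' β' j₂ j₂' p).2

end Closed

/-! ## §4 Trace-form coordinates supplied — no hypothesis left but numbers -/

section Unconditional

variable [Nonempty mm]

/-- ★★★ **GUARD ∧ `N15At` AT THE ONE-PROPAGATOR LITERAL, TRACE-FORM COORDINATES SUPPLIED** (`e := tfCoords mm`, `ι := Fin 2 × mm × mm`; (T-1) `traceForm_eq_tfCoords_dotProduct`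
discharges `he`): the remaining hypotheses are PURELY NUMERIC — `1 ≤ d`, odd `L ≥ 7`, `0 < a`, `0 < c₃₅` — plus `mm` nonempty. MODEL carriers; NOT [B9] Thms 3.1∕3.2∕3.15 AS PRINTED.
[cite: Balaban1985BackgroundPropagators, (3.42) p.397, Thms 3.1∕3.2 p.398, Thm 3.15 p.432 (shape)] -/
theorem live_and_n15At_sfObjects₆qv_tf (hd : 1 ≤ d) (hL : Odd L ∧ 1 < L) (hL7 : 7 ≤ L) (ha : 0 < a) {c35 : ℝ} (hc35 : 0 < c35)
    (ν₁ ν₂ : Fin (d + 1) ⊕ Fin (d + 1)) (α β : Fin (d + 1)) (j j' : Fin 2 × mm × mm) (α' β' : Fin (d + 1)) (j₂ j₂' : Fin 2 × mm × mm) (p : ℝ) :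
    Live (ne2OfRecord₁₁ (sfObjects₆qv d mm (Fin 2 × mm × mm) a (TraceFormCoords.tfCoords mm) hL ν₁ ν₂ α β j j' α' β' j₂ j₂' c35 p
        (wQ6 d mm (Fin 2 × mm × mm) a (TraceFormCoords.tfCoords mm) hd hL hL7 ha hc35 (TraceFormCoords.traceForm_eq_tfCoords_dotProduct mm) ν₁ ν₂ α β j j' α' β' j₂ j₂' p))) ∧
      N15At (ne2OfRecord₁₁ (sfObjects₆qv d mm (Fin 2 × mm × mm) a (TraceFormCoords.tfCoords mm) hL ν₁ ν₂ α β j j' α' β' j₂ j₂' c35 p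
        (wQ6 d mm (Fin 2 × mm × mm) a (TraceFormCoords.tfCoords mm) hd hL hL7 ha hc35 (TraceFormCoords.traceForm_eq_tfCoords_dotProduct mm) ν₁ ν₂ α β j j' α' β' j₂ j₂' p))) :=
  live_and_n15At_sfObjects₆qv_wQ6 d mm (Fin 2 × mm × mm) a (TraceFormCoords.tfCoords mm) hd hL hL7 ha hc35 (TraceFormCoords.traceForm_eq_tfCoords_dotProduct mm) ν₁ ν₂ α β j j' α' β' j₂ j₂' p

end Unconditional

end Summit.QuantumFields.YangMills.BalabanUVNodes.N15.SiteLayerSf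

end
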